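import Summits.QuantumFields.YangMills.Theorems.LuscherReductionTwistedTraceScalingToronLinkSpectrum
import Summits.QuantumFields.YangMills.Theorems.LuscherReductionTwistedTraceScalingToronValley
import Literature.Analysis.OperatorTheory.GaussianTransferKernelSupersolutionFrame
import HarnessLib

/-!
# C3b-MODEL: the FATTENED HARMONIC VALLEY STEP at a constant abelian background, in closed form —
# `∫ e^{−t‖D_θx‖²} e^{−b‖x−y‖²} e^{−t‖D_θy‖²} h_ε(y) dy ≤ (1−ε)^{−n/2}·√(π/b)^n·e^{−[2Z_κ(0)+4Z_κ(2θ)]}·e^{−(ε/2)t‖D_θx‖²}·h_ε(x)`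
# (VALLEY term of S-BASE, crux `TwistedTraceScaling` stmt-QuantumFields-20203; design `pub/ym-fleet/ym-luscher-20007-p1/COARSE-DESIGN.md` §12 addendum)

Here `D_θ = covCurl (abelianCfg L θ)` is the covariant curl at the flat background `V_θ` (lane B, `…CovariantCurl`), `n = 9L³ = dim LinkSpace`,
`κ = t/b`, `Z_κ(α) = toronZPE L κ 0 α`, and `h_ε(x) = exp(−(1−ε)Σᵢ cᵢ⟪eᵢ,x⟫²)` is the harmonic ground state at `V_θ` (Riccati exponents
`cᵢ = √((taᵢ)² + 2taᵢb)` in ANY orthonormal eigenframe `(eᵢ, aᵢ)` of `‖D_θ·‖²`) FATTENED by the factor `1−ε`.  The three factors of the bound are the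
three mechanisms of the valley Schur test (design §12 addendum): the prefactor loses at most `(1−ε)^{−1/2}` per mode; the toron zero-point sum
`2Z(0) + 4Z(2θ)` (C3a, `…ToronLinkSpectrum`) carries the TWIST GAIN (`…ToronValley.toronZPE_gain_of_valley`: `4Z(2θ) ≥ 4Z(0) + 4·gain1Slope·√2δ/(3L³)`
on the valley); and the fattening produces the STIFF GAIN `e^{−(ε/2)·t‖D_θx‖²}` (per-mode gain rate `κᵢ ≥ (ε/2)·taᵢ`, `gainRate_ge`).
* `riccati A b = √(A²+2Ab)`; `gainRate_ge`; `sqrt_pi_div_fat_le`;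
* ★★★ `valleyModelStep_le` (any diagonalising frame), ★★★ `valleyModelStep_le_of_valley` (with the toron gain inserted: valley hypothesis
  `∀ z, δ < orbitDist(τ_z V_θ)` ⇒ factor `e^{−6Z_κ(0)}·e^{−4·gain1Slope L κ·√2δ/(3L³)}`);
* ★ `exists_norm_gt_of_valley_near`, ★ `valley_dichotomy`: on the valley, for every `V_θ`, either `d(U,V_θ) ≥ δ/2` (stiff excursion) or
  `‖2θ_k‖ > √2δ/(6L³)` (twist far from the torons).
What is NOT here: the sandwich between the true transfer kernel at `V_θ·(fluctuation)` and this harmonic model (lane B's step-locality bricks), the geometry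
`valleyRegion ⇒ near some V_θ` (lane B c5), and the `k = 0` lower bound — the remaining inputs of `ValleyRowBoundAt`.

HONEST FRAMING: Gaussian calculus at fixed `L`; femto rung R2b1 (brick for a stub of a child of a CONDITIONAL route); not a gap, not Clay.
-/

set_option autoImplicit false

noncomputable section

open Finset MeasureTheory
open scoped BigOperators InnerProductSpace RealInnerProductSpace
open Literature.MathematicalPhysics.QuantumFieldTheory
open Literature.MathematicalPhysics.QuantumLattice
open Literature.Analysis.OperatorTheory.GaussianTransferKernel

namespace Summit.QuantumFields.YangMills.Theorems.FemtoTransferGap.TwoLattice.Toron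

open Summit.QuantumFields.YangMills.Theorems.FemtoTransferGap
open Summit.QuantumFields.YangMills.Theorems.FemtoTransferGap.TwoLattice.Cov
open Summit.QuantumFields.YangMills.Theorems.FemtoTransferGap.TwoLattice.Stiff

/-! ## §1 Scalar bookkeeping of one fattened mode -/

/-- The Riccati exponent of the harmonic mode `e^{−Ax²}e^{−b(x−y)²}e^{−Ay²}`: `c = √(A² + 2Ab)` (`h = e^{−cx²}` is its exact ground state).
[cite: Wipf2021, §8.5.1 (8.56)–(8.57)] -/
def riccati (A b : ℝ) : ℝ := Real.sqrt (A ^ 2 + 2 * A * b)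

/-- `c ≥ 0`. [folklore] -/
theorem riccati_nonneg (A b : ℝ) : 0 ≤ riccati A b := Real.sqrt_nonneg _

/-- `c² = A² + 2Ab` (`A, b ≥ 0`). [folklore] -/
theorem riccati_sq {A b : ℝ} (hA : 0 ≤ A) (hb : 0 ≤ b) : riccati A b ^ 2 = A ^ 2 + 2 * A * b :=
  Real.sq_sqrt (by positivity)

/-- `c ≤ A + b` (`A, b ≥ 0`). [folklore] -/
theorem riccati_le {A b : ℝ} (hA : 0 ≤ A) (hb : 0 ≤ b) : riccati A b ≤ A + b := by
  unfold riccati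
  calc Real.sqrt (A ^ 2 + 2 * A * b) ≤ Real.sqrt ((A + b) ^ 2) := Real.sqrt_le_sqrt (by nlinarith)
    _ = A + b := Real.sqrt_sq (by positivity)

/-- ★ **Gain rate of the fattened weight**: for `A ≥ 0`, `b > 0`, `0 ≤ ε ≤ 1`, `c = √(A²+2Ab)`, `c' = (1−ε)c`:
`κ = (A² + 2Ab − c'²)/(A + b + c') ≥ (ε/2)·A`. [cite: Wipf2021, §8.5.1 (8.57)] -/
theorem gainRate_ge {A b ε : ℝ} (hA : 0 ≤ A) (hb : 0 < b) (hε0 : 0 ≤ ε) (hε1 : ε ≤ 1) :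
    ε / 2 * A ≤ (A ^ 2 + 2 * A * b - ((1 - ε) * riccati A b) ^ 2) / (A + b + (1 - ε) * riccati A b) := by
  have hc0 := riccati_nonneg A b
  have hc2 := riccati_sq hA hb.le
  have hcle := riccati_le hA hb.le
  have h1ε : 0 ≤ 1 - ε := by linarith
  have hs : 0 < A + b + (1 - ε) * riccati A b := by nlinarith [mul_nonneg h1ε hc0]
  rw [le_div_iff₀ hs]
  have e1 : ((1 - ε) * riccati A b) ^ 2 = (1 - ε) ^ 2 * (A ^ 2 + 2 * A * b) := by rw [mul_pow, hc2]
  rw [e1]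
  have h2 : (1 - ε) * riccati A b ≤ A + b := by nlinarith [mul_nonneg hε0 hc0]
  have h3 : ε / 2 * A * (A + b + (1 - ε) * riccati A b) ≤ ε * A * (A + b) := by nlinarith [mul_nonneg hε0 hA]
  nlinarith [mul_nonneg hε0 (mul_nonneg hA hb.le), mul_nonneg (mul_nonneg hε0 h1ε) (by positivity : (0 : ℝ) ≤ A ^ 2 + 2 * A * b)]

/-- ★ **Prefactor loss of the fattened weight**: `√(π/(A + b + (1−ε)c)) ≤ (√(1−ε))⁻¹ · √(π/(A + b + c))` (`A ≥ 0`, `b > 0`, `0 ≤ ε < 1`).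
[folklore] -/
theorem sqrt_pi_div_fat_le {A b ε : ℝ} (hA : 0 ≤ A) (hb : 0 < b) (hε0 : 0 ≤ ε) (hε1 : ε < 1) :
    Real.sqrt (Real.pi / (A + b + (1 - ε) * riccati A b)) ≤ (Real.sqrt (1 - ε))⁻¹ * Real.sqrt (Real.pi / (A + b + riccati A b)) := by
  have hc0 := riccati_nonneg A b
  have h1ε : 0 < 1 - ε := by linarith
  have hs : 0 < A + b + riccati A b := by linarith
  have h1 : (A + b + riccati A b) * (1 - ε) ≤ A + b + (1 - ε) * riccati A b := by nlinarith
  have h2 : Real.pi / (A + b + (1 - ε) * riccati A b) ≤ Real.pi / ((A + b + riccati A b) * (1 - ε)) :=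
    div_le_div_of_nonneg_left Real.pi_pos.le (by positivity) h1
  calc Real.sqrt (Real.pi / (A + b + (1 - ε) * riccati A b))
      ≤ Real.sqrt (Real.pi / ((A + b + riccati A b) * (1 - ε))) := Real.sqrt_le_sqrt h2
    _ = (Real.sqrt (1 - ε))⁻¹ * Real.sqrt (Real.pi / (A + b + riccati A b)) := by
        rw [div_mul_eq_div_div, Real.sqrt_div' _ h1ε.le, div_eq_inv_mul]

/-! ## §2 The fattened harmonic step at `V_θ` -/

variable (L : ℕ) [NeZero L]

/-- ★★★ **FATTENED HARMONIC VALLEY STEP at `V_θ`** (any orthonormal eigenframe `(e, a)` of `‖D_{V_θ}·‖²`; `t ≥ 0`, `b > 0`, `0 ≤ ε < 1`,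
`cᵢ = √((taᵢ)²+2taᵢb)`):
`∫ e^{−t‖D_θx‖²}e^{−b‖x−y‖²}e^{−t‖D_θy‖²} e^{−Σ(1−ε)cᵢ⟪eᵢ,y⟫²} dy
   ≤ (√(1−ε))^{−n} · √(π/b)^n · e^{−[2·toronZPE L (t/b) 0 0 + 4·toronZPE L (t/b) 0 (2θ)]} · e^{−(ε/2)t‖D_θx‖²} · e^{−Σ(1−ε)cᵢ⟪eᵢ,x⟫²}`,
`n = |ι| = 9L³`. [cite: Wipf2021, §8.5.2 (8.64)–(8.67)] [cite: Luscher1983, §3] -/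
theorem valleyModelStep_le (θ : Fin 3 → ℝ) {ι : Type*} [Fintype ι] [DecidableEq ι] {e : OrthonormalBasis ι ℝ (LinkSpace L)} {a : ι → ℝ}
    (h : Frame.IsDiag (covCurl (abelianCfg L θ)) e a) {t b ε : ℝ} (ht : 0 ≤ t) (hb : 0 < b) (hε0 : 0 ≤ ε) (hε1 : ε < 1)
    (x : LinkSpace L) :
    ∫ y, Real.exp (-(t * ‖covCurl (abelianCfg L θ) x‖ ^ 2)) * Real.exp (-(b * ‖x - y‖ ^ 2)) *
        Real.exp (-(t * ‖covCurl (abelianCfg L θ) y‖ ^ 2)) * Real.exp (-(∑ i, (1 - ε) * riccati (t * a i) b * ⟪e i, y⟫_ℝ ^ 2)) ≤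
      (Real.sqrt (1 - ε))⁻¹ ^ Fintype.card ι * Real.sqrt (Real.pi / b) ^ Fintype.card ι *
        Real.exp (-(2 * toronZPE L (t / b) 0 0 + 4 * toronZPE L (t / b) 0 (fun k => 2 * θ k))) *
        Real.exp (-(ε / 2 * t * ‖covCurl (abelianCfg L θ) x‖ ^ 2)) *
        Real.exp (-(∑ i, (1 - ε) * riccati (t * a i) b * ⟪e i, x⟫_ℝ ^ 2)) := by
  have ha0 : ∀ i, 0 ≤ t * a i := fun i => mul_nonneg ht (h.nonneg i)
  have hc0 : ∀ i, 0 ≤ (1 - ε) * riccati (t * a i) b := fun i => mul_nonneg (by linarith) (riccati_nonneg _ _)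
  -- the kernel in the frame
  have hD : ∀ z : LinkSpace L, t * ‖covCurl (abelianCfg L θ) z‖ ^ 2 = ∑ i, t * a i * ⟪e i, z⟫_ℝ ^ 2 := fun z => by
    rw [h.norm_sq_eq_sum_real z, mul_sum]
    exact sum_congr rfl fun i _ => by ring
  simp_rw [hD]
  rw [integral_gaussKernel_mul_gaussian_frame e ha0 hb hc0 x]
  have hZ : ∑ i, modeZPE (t * a i / b) = 2 * toronZPE L (t / b) 0 0 + 4 * toronZPE L (t / b) 0 (fun k => 2 * θ k) := by
    rw [← sum_modeZPE_of_isDiag_covCurl_abelianCfg L θ h (t / b)]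
    exact sum_congr rfl fun i _ => by rw [div_mul_eq_mul_div]
  -- (1) the prefactor
  have hP : ∏ i, Real.sqrt (Real.pi / (t * a i + b + (1 - ε) * riccati (t * a i) b)) ≤
      (Real.sqrt (1 - ε))⁻¹ ^ Fintype.card ι * Real.sqrt (Real.pi / b) ^ Fintype.card ι *
        Real.exp (-(2 * toronZPE L (t / b) 0 0 + 4 * toronZPE L (t / b) 0 (fun k => 2 * θ k))) := by
    calc ∏ i, Real.sqrt (Real.pi / (t * a i + b + (1 - ε) * riccati (t * a i) b))
        ≤ ∏ i, ((Real.sqrt (1 - ε))⁻¹ * Real.sqrt (Real.pi / (t * a i + b + riccati (t * a i) b))) :=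
          prod_le_prod (fun i _ => Real.sqrt_nonneg _) fun i _ => sqrt_pi_div_fat_le (ha0 i) hb hε0 hε1
      _ = (Real.sqrt (1 - ε))⁻¹ ^ Fintype.card ι * (Real.sqrt (Real.pi / b) ^ Fintype.card ι *
            Real.exp (-∑ i, modeZPE (t * a i / b))) := by
          rw [prod_mul_distrib, prod_const, card_univ,
            prod_sqrt_pi_div_eq ha0 hb (fun i => riccati_nonneg _ _) (fun i => riccati_sq (ha0 i) hb.le)]
      _ = _ := by rw [hZ, mul_assoc]
  -- (2) the Gaussian gain
  have hG : Real.exp (-(∑ i, ((t * a i) ^ 2 + 2 * (t * a i) * b - ((1 - ε) * riccati (t * a i) b) ^ 2) /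
        (t * a i + b + (1 - ε) * riccati (t * a i) b) * ⟪e i, x⟫_ℝ ^ 2)) ≤
      Real.exp (-(ε / 2 * t * ∑ i, a i * ⟪e i, x⟫_ℝ ^ 2)) := by
    refine Real.exp_le_exp.mpr (neg_le_neg ?_)
    rw [mul_sum]
    refine sum_le_sum fun i _ => ?_
    have := gainRate_ge (ha0 i) hb hε0 hε1.le
    calc ε / 2 * t * (a i * ⟪e i, x⟫_ℝ ^ 2) = ε / 2 * (t * a i) * ⟪e i, x⟫_ℝ ^ 2 := by ring
      _ ≤ _ := mul_le_mul_of_nonneg_right this (sq_nonneg _)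
  rw [← h.norm_sq_eq_sum_real x] at hG
  exact mul_le_mul_of_nonneg_right (mul_le_mul hP hG (Real.exp_pos _).le (by positivity)) (Real.exp_pos _).le

/-- ★★★ **The same on the VALLEY, with the toron gain inserted**: if every centre twist of `V_θ` is at orbit distance `> δ` from the vacuum
(`t > 0`), the zero-point factor is at most `e^{−6·Z_κ(0)}·e^{−4·gain1Slope L κ·√2δ/(3L³)}` (`κ = t/b`): twist gain AND stiff gain in one bound.
[cite: Luscher1983, §3] -/
theorem valleyModelStep_le_of_valley (θ : Fin 3 → ℝ) {ι : Type*} [Fintype ι] [DecidableEq ι] {e : OrthonormalBasis ι ℝ (LinkSpace L)}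
    {a : ι → ℝ} (h : Frame.IsDiag (covCurl (abelianCfg L θ)) e a) {t b ε δ : ℝ} (ht : 0 < t) (hb : 0 < b) (hε0 : 0 ≤ ε) (hε1 : ε < 1)
    (hval : ∀ z : Fin 3 → Bool, δ < orbitDist (TT.twist3 z (abelianCfg L θ))) (x : LinkSpace L) :
    ∫ y, Real.exp (-(t * ‖covCurl (abelianCfg L θ) x‖ ^ 2)) * Real.exp (-(b * ‖x - y‖ ^ 2)) *
        Real.exp (-(t * ‖covCurl (abelianCfg L θ) y‖ ^ 2)) * Real.exp (-(∑ i, (1 - ε) * riccati (t * a i) b * ⟪e i, y⟫_ℝ ^ 2)) ≤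
      (Real.sqrt (1 - ε))⁻¹ ^ Fintype.card ι * Real.sqrt (Real.pi / b) ^ Fintype.card ι *
        (Real.exp (-(6 * toronZPE L (t / b) 0 0)) *
          Real.exp (-(4 * (gain1Slope L (t / b) * (Real.sqrt 2 * δ / (3 * (L : ℝ) ^ 3)))))) *
        Real.exp (-(ε / 2 * t * ‖covCurl (abelianCfg L θ) x‖ ^ 2)) *
        Real.exp (-(∑ i, (1 - ε) * riccati (t * a i) b * ⟪e i, x⟫_ℝ ^ 2)) := by
  have hκ : 0 < t / b := div_pos ht hb
  have hgain := toronZPE_gain_of_valley L hκ θ hval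
  have h0 : toronZPE L (t / b) 0 (fun _ => 0) = toronZPE L (t / b) 0 0 := rfl
  rw [h0] at hgain
  refine (valleyModelStep_le L θ h ht.le hb hε0 hε1 x).trans ?_
  refine mul_le_mul_of_nonneg_right (mul_le_mul_of_nonneg_right (mul_le_mul_of_nonneg_left ?_ (by positivity))
    (Real.exp_pos _).le) (Real.exp_pos _).le
  rw [← Real.exp_add]
  exact Real.exp_le_exp.mpr (by linarith)

/-! ## §3 The valley dichotomy for a general configuration near `V_θ` -/

/-- ★ **Valley ⇒ twist gain up to the fluctuation size**: if every twisted orbit distance of `U` exceeds `δ`, then for EVERY flat background `V_θ`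
some adjoint phase satisfies `‖(2θ_k : AddCircle(2π/L))‖ > √2·(δ − d(U,V_θ))/(3L³)`, `d(U,V_θ) = Σ_e ‖U_e − (V_θ)_e‖_F` (link-Lipschitz continuity of the
twisted orbit distances + `exists_norm_gt_of_valley`). [cite: Luscher1983, §3] -/
theorem exists_norm_gt_of_valley_near (θ : Fin 3 → ℝ) (U : GaugeConfig 3 L SU2) {δ : ℝ}
    (hU : ∀ z : Fin 3 → Bool, δ < orbitDist (TT.twist3 z U)) :
    ∃ k : Fin 3, Real.sqrt 2 * (δ - ∑ e : Edge 3 L, frobNorm (((U e : SU2) : Matrix (Fin 2) (Fin 2) ℂ) -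
        ((abelianCfg L θ e : SU2) : Matrix (Fin 2) (Fin 2) ℂ))) / (3 * (L : ℝ) ^ 3) <
      ‖((2 * θ k : ℝ) : AddCircle (2 * Real.pi / L))‖ := by
  refine exists_norm_gt_of_valley θ fun z => ?_
  have h1 := (abs_le.mp (abs_orbitDist_twist3_sub_le z U (abelianCfg L θ))).2
  linarith [hU z]

/-- ★ **THE VALLEY DICHOTOMY**: on the valley (`orbitDist(τ_z U) > δ` for all `z`), for every flat background `V_θ` EITHER the configuration is a stiff
excursion of size `d(U, V_θ) ≥ δ/2` OR the background's twist is far from the torons: `‖2θ_k‖ > √2·δ/(6L³)` for some `k` — the two gains of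
`valleyModelStep_le_of_valley`. [cite: Luscher1983, §3] -/
theorem valley_dichotomy (θ : Fin 3 → ℝ) (U : GaugeConfig 3 L SU2) {δ : ℝ} (hU : ∀ z : Fin 3 → Bool, δ < orbitDist (TT.twist3 z U)) :
    δ / 2 ≤ ∑ e : Edge 3 L, frobNorm (((U e : SU2) : Matrix (Fin 2) (Fin 2) ℂ) - ((abelianCfg L θ e : SU2) : Matrix (Fin 2) (Fin 2) ℂ)) ∨
      ∃ k : Fin 3, Real.sqrt 2 * δ / (6 * (L : ℝ) ^ 3) < ‖((2 * θ k : ℝ) : AddCircle (2 * Real.pi / L))‖ := by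
  set d := ∑ e : Edge 3 L, frobNorm (((U e : SU2) : Matrix (Fin 2) (Fin 2) ℂ) - ((abelianCfg L θ e : SU2) : Matrix (Fin 2) (Fin 2) ℂ))
    with hd_def
  by_cases hd : δ / 2 ≤ d
  · exact Or.inl hd
  · refine Or.inr ?_
    obtain ⟨k, hk⟩ := exists_norm_gt_of_valley_near L θ U hU
    rw [← hd_def] at hk
    refine ⟨k, lt_of_le_of_lt ?_ hk⟩
    have hL0 : (0 : ℝ) < L := by exact_mod_cast NeZero.pos L
    have hL : (0 : ℝ) < 3 * (L : ℝ) ^ 3 := by positivity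
    have hL' : (0 : ℝ) < 6 * (L : ℝ) ^ 3 := by positivity
    rw [div_le_div_iff₀ hL' hL]
    have hpos : 0 < Real.sqrt 2 * (3 * (L : ℝ) ^ 3) * (δ - 2 * d) :=
      mul_pos (mul_pos (Real.sqrt_pos.mpr two_pos) hL) (by linarith [not_le.mp hd])
    nlinarith [hpos]

end Summit.QuantumFields.YangMills.Theorems.FemtoTransferGap.TwoLattice.Toron

end
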